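import Summits.Ventures.Crystal3D.Theorems.StickyWulffConstantCoaxialWallLawWordLetters
import Summits.Ventures.Crystal3D.Theorems.StickyWulffConstantCoaxialWallLawModelChain
import Summits.Ventures.Crystal3D.Theorems.StickyWulffConstantCoaxialWallLawSlotTriangle
import HarnessLib

/-!
# Word rigidity: a well-formed word is determined by the slot dozen of its frame (v2 line automaton, W7)

HONEST FRAMING. Part of the venture `Summits/Ventures/Crystal3D` (cell `crystal3d-full`), helper for the
crux `CoaxialWallLaw` (stmt-Ventures-19481) of `route-Ventures-StickyWulffConstant`, REGISTERED line
`WallLedgerF` (planner cf-p1 gen 16), open stub `stub_coaxialTwoSlabAdhesion` (general fillings).  Brick W7 of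
the v2 (NET) line automaton (memo F-NET-AUTOMATON-v2 §7, evidence on the crux item): the RIGIDITY input of
the abstract count `word_sources_le` («a class whose frame shares a `60°` triangle with the frame of `root`
(`lam`) is `root` (`lam`)») for the instantiation by WORDS.  Rung credit only; F-C1 not moved.

SETTING (equations, as in `…WordLetters`): classes are lists `κ = [μ₁, …, μ_k]` of model `{111}` normals
(most recent first), `F (μ :: κ) = F κ ∘ R_μ` (`hFc`), `u (μ :: κ) = −u κ` (`huc`), and `WF` the
well-formedness predicate (`hWFc`: unit model menu letters, `⟪u κ', μ⟫ = +√(2/3)` when `μ` is pushed onto `κ'`,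
and `μ ≠ −head κ'`).

* `word_F_append_apply` — `F (α ++ τ) x = F τ (foldl R α x)` (the prefix acts first, head first);
* `foldl_reflect_reverse_foldl` — `foldl R α.reverse (foldl R α x) = x` (mirrors are involutions);
* `word_letters_of_wf` — the letters of a well-formed word are unit model menu normals and consecutive letters
  meet at `⟪μ, μ'⟫ = ±1/3` (they are distinct — `⟪u, μ⟫ = +√(2/3) = −⟪u, μ'⟫` is impossible for `μ = μ'` — and not
  antipodal by `WF`, and two model menu normals meet at `±1` or `±1/3`, `inner_menuNormals`);
* `word_inner_u_getLast` — the deepest letter `a` of a prefix `α` of a well-formed word `α ++ τ` has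
  `⟪u τ, a⟫ = +√(2/3)`;
* `exists_common_suffix` — any two lists split as `α ++ τ`, `α' ++ τ` with distinct deepest prefix letters;
* **`word_eq_of_image_eq`** — for well-formed `κ, κ'`: `F κ '' fccSlots = F κ' '' fccSlots → κ = κ'`.  Proof:
  split off the longest common suffix `τ`; then `foldl R (α ++ α'.reverse)` maps `fccSlots` into itself, the
  list `α ++ α'.reverse` is a `±1/3`-chain of unit model menu normals (inside `α`, `α'` by `word_letters_of_wf`;
  at the junction the two deepest letters are distinct, and not antipodal because both pair to `+√(2/3)` with
  `u τ`), so `foldl_reflect_slots_false` (NonReturn) forces `α = α' = []`;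
* **`word_eq_of_triangle`** — the form consumed by `word_sources_le` (`hroot`/`hlam`): a `60°` triangle of
  `F κ`-slots inside the slot dozen of `F κ'` forces `κ = κ'` (`image_fccSlots_eq_of_triangle`).

WHAT THIS IS NOT: not the stub; F-C1 not moved.
-/

noncomputable section

namespace Summit.Ventures.Crystal3D.Theorems

open Summit.Ventures.Crystal3D Finset
open Literature.MathematicalPhysics.StatisticalMechanics (fccStacking)
open scoped InnerProductSpace

section Rigidity

variable {F : List (EuclideanSpace ℝ (Fin 3)) → (EuclideanSpace ℝ (Fin 3) ≃ₗᵢ[ℝ] EuclideanSpace ℝ (Fin 3))}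
  {u : List (EuclideanSpace ℝ (Fin 3)) → EuclideanSpace ℝ (Fin 3)}
  {WF : List (EuclideanSpace ℝ (Fin 3)) → Prop}

/-- A unit mirror is an involution: `R_μ (R_μ x) = x`. -/
theorem reflect_reflect_unit {μ : EuclideanSpace ℝ (Fin 3)} (hμ : ‖μ‖ = 1) (x : EuclideanSpace ℝ (Fin 3)) :
    (x - (2 * ⟪x, μ⟫_ℝ) • μ) - (2 * ⟪x - (2 * ⟪x, μ⟫_ℝ) • μ, μ⟫_ℝ) • μ = x := by
  rw [inner_sub_left, real_inner_smul_left, real_inner_self_eq_norm_sq, hμ]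
  module

/-- **The prefix acts first**: `F (α ++ τ) x = F τ (foldl R α x)` for unit letters `α`. -/
theorem word_F_append_apply (hFc : ∀ μ κ, F (μ :: κ) = ((ℝ ∙ μ)ᗮ.reflection).trans (F κ)) :
    ∀ (α : List (EuclideanSpace ℝ (Fin 3))), (∀ μ ∈ α, ‖μ‖ = 1) →
      ∀ (τ : List (EuclideanSpace ℝ (Fin 3))) (x : EuclideanSpace ℝ (Fin 3)),
        F (α ++ τ) x = F τ (α.foldl (fun (y : EuclideanSpace ℝ (Fin 3)) μ => y - (2 * ⟪y, μ⟫_ℝ) • μ) x) := by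
  intro α
  induction α with
  | nil => intro _ τ x; rfl
  | cons μ α ih =>
    intro hα τ x
    have hμ : ‖μ‖ = 1 := hα μ (by simp)
    have hα' : ∀ ν ∈ α, ‖ν‖ = 1 := fun ν hν => hα ν (by simp [hν])
    rw [List.cons_append, word_F_cons_apply hFc hμ, ih hα', List.foldl_cons]

/-- **Mirrors undo in reverse order**: `foldl R α.reverse (foldl R α x) = x` for unit letters. -/
theorem foldl_reflect_reverse_foldl :
    ∀ (α : List (EuclideanSpace ℝ (Fin 3))), (∀ μ ∈ α, ‖μ‖ = 1) → ∀ x : EuclideanSpace ℝ (Fin 3),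
      α.reverse.foldl (fun (y : EuclideanSpace ℝ (Fin 3)) μ => y - (2 * ⟪y, μ⟫_ℝ) • μ)
        (α.foldl (fun (y : EuclideanSpace ℝ (Fin 3)) μ => y - (2 * ⟪y, μ⟫_ℝ) • μ) x) = x := by
  intro α
  induction α with
  | nil => intro _ x; rfl
  | cons μ α ih =>
    intro hα x
    have hμ : ‖μ‖ = 1 := hα μ (by simp)
    have hα' : ∀ ν ∈ α, ‖ν‖ = 1 := fun ν hν => hα ν (by simp [hν])
    simp only [List.reverse_cons, List.foldl_append, List.foldl_cons, List.foldl_nil]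
    rw [ih hα', reflect_reflect_unit hμ]

/-- Two unit vectors with inner product `−1` are antipodal. -/
theorem eq_neg_of_inner_eq_neg_one' {x y : EuclideanSpace ℝ (Fin 3)} (hx : ‖x‖ = 1) (hy : ‖y‖ = 1)
    (h : ⟪x, y⟫_ℝ = -1) : y = -x := by
  have h' : ⟪x, -y⟫_ℝ = 1 := by rw [inner_neg_right, h, neg_neg]
  have := (inner_eq_one_iff_of_norm_eq_one (𝕜 := ℝ) hx (by rw [norm_neg, hy])).1 h'
  rw [this, neg_neg]

/-- A well-formed word has a well-formed suffix. -/
theorem word_wf_of_append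
    (hWFc : ∀ μ κ, WF (μ :: κ) ↔ (WF κ ∧ ‖μ‖ = 1 ∧
      (∀ w ∈ fccSlots, ⟪w, μ⟫_ℝ = 0 ∨ ⟪w, μ⟫_ℝ = Real.sqrt (2 / 3) ∨ ⟪w, μ⟫_ℝ = -Real.sqrt (2 / 3)) ∧
      ⟪u κ, μ⟫_ℝ = Real.sqrt (2 / 3) ∧ ∀ μ' κ', κ = μ' :: κ' → μ' ≠ -μ)) :
    ∀ (α τ : List (EuclideanSpace ℝ (Fin 3))), WF (α ++ τ) → WF τ := by
  intro α
  induction α with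
  | nil => intro τ h; exact h
  | cons μ α ih => intro τ h; exact ih τ ((hWFc μ (α ++ τ)).1 h).1

/-- **Letters of a well-formed word**: unit model menu normals, consecutive ones at `±1/3`. -/
theorem word_letters_of_wf (huc : ∀ μ κ, u (μ :: κ) = -u κ)
    (hWFc : ∀ μ κ, WF (μ :: κ) ↔ (WF κ ∧ ‖μ‖ = 1 ∧
      (∀ w ∈ fccSlots, ⟪w, μ⟫_ℝ = 0 ∨ ⟪w, μ⟫_ℝ = Real.sqrt (2 / 3) ∨ ⟪w, μ⟫_ℝ = -Real.sqrt (2 / 3)) ∧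
      ⟪u κ, μ⟫_ℝ = Real.sqrt (2 / 3) ∧ ∀ μ' κ', κ = μ' :: κ' → μ' ≠ -μ)) :
    ∀ κ, WF κ →
      (∀ μ ∈ κ, ‖μ‖ = 1 ∧
        ∀ w ∈ fccSlots, ⟪w, μ⟫_ℝ = 0 ∨ ⟪w, μ⟫_ℝ = Real.sqrt (2 / 3) ∨ ⟪w, μ⟫_ℝ = -Real.sqrt (2 / 3)) ∧
      List.IsChain (fun μ μ' => ⟪μ, μ'⟫_ℝ = 1 / 3 ∨ ⟪μ, μ'⟫_ℝ = -1 / 3) κ := by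
  have hr : 0 < Real.sqrt (2 / 3) := Real.sqrt_pos.2 (by norm_num)
  intro κ
  induction κ with
  | nil => intro _; exact ⟨fun μ hμ => by simp at hμ, List.isChain_nil⟩
  | cons μ κ ih =>
    intro hκ
    obtain ⟨hκ', hμ, hmenu, hμu, hnopop⟩ := (hWFc μ κ).1 hκ
    obtain ⟨hlet, hchain⟩ := ih hκ'
    refine ⟨fun ν hν => ?_, ?_⟩
    · rcases List.mem_cons.1 hν with rfl | hν
      · exact ⟨hμ, hmenu⟩
      · exact hlet ν hν
    · rw [List.isChain_cons]
      refine ⟨fun μ' hμ' => ?_, hchain⟩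
      -- `κ = μ' :: κ''`
      obtain ⟨κ'', rfl⟩ : ∃ κ'', κ = μ' :: κ'' := by
        cases κ with
        | nil => simp at hμ'
        | cons a l => simp at hμ'; exact ⟨l, by rw [hμ']⟩
      obtain ⟨-, hμ'1, hmenu', hμ'u, -⟩ := (hWFc μ' κ'').1 hκ'
      rw [huc] at hμu
      rw [inner_neg_left] at hμu
      have hmenuR : ∀ w ∈ fccSlots,
          ⟪(LinearIsometryEquiv.refl ℝ (EuclideanSpace ℝ (Fin 3))) w, μ⟫_ℝ = 0 ∨
          ⟪(LinearIsometryEquiv.refl ℝ (EuclideanSpace ℝ (Fin 3))) w, μ⟫_ℝ = Real.sqrt (2 / 3) ∨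
          ⟪(LinearIsometryEquiv.refl ℝ (EuclideanSpace ℝ (Fin 3))) w, μ⟫_ℝ = -Real.sqrt (2 / 3) := by
        intro w hw; simpa using hmenu w hw
      have hmenuR' : ∀ w ∈ fccSlots,
          ⟪(LinearIsometryEquiv.refl ℝ (EuclideanSpace ℝ (Fin 3))) w, μ'⟫_ℝ = 0 ∨
          ⟪(LinearIsometryEquiv.refl ℝ (EuclideanSpace ℝ (Fin 3))) w, μ'⟫_ℝ = Real.sqrt (2 / 3) ∨
          ⟪(LinearIsometryEquiv.refl ℝ (EuclideanSpace ℝ (Fin 3))) w, μ'⟫_ℝ = -Real.sqrt (2 / 3) := by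
        intro w hw; simpa using hmenu' w hw
      rcases inner_menuNormals (LinearIsometryEquiv.refl ℝ _) hμ hμ'1 hmenuR hmenuR' with h | h | h | h
      · -- equal letters: `⟪u κ'', μ⟫ = −√(2/3)` and `= +√(2/3)`
        have heq : μ = μ' := (inner_eq_one_iff_of_norm_eq_one (𝕜 := ℝ) hμ hμ'1).1 h
        rw [heq, hμ'u] at hμu
        linarith
      · exact absurd (eq_neg_of_inner_eq_neg_one' hμ hμ'1 h) (hnopop μ' κ'' rfl)
      · exact Or.inl h
      · exact Or.inr h

/-- **The deepest prefix letter was pushed onto the suffix**: `⟪u τ, a⟫ = +√(2/3)` for `a = getLast α`. -/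
theorem word_inner_u_getLast
    (hWFc : ∀ μ κ, WF (μ :: κ) ↔ (WF κ ∧ ‖μ‖ = 1 ∧
      (∀ w ∈ fccSlots, ⟪w, μ⟫_ℝ = 0 ∨ ⟪w, μ⟫_ℝ = Real.sqrt (2 / 3) ∨ ⟪w, μ⟫_ℝ = -Real.sqrt (2 / 3)) ∧
      ⟪u κ, μ⟫_ℝ = Real.sqrt (2 / 3) ∧ ∀ μ' κ', κ = μ' :: κ' → μ' ≠ -μ)) :
    ∀ (α τ : List (EuclideanSpace ℝ (Fin 3))), WF (α ++ τ) →
      ∀ a ∈ α.getLast?, ⟪u τ, a⟫_ℝ = Real.sqrt (2 / 3) := by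
  intro α
  induction α with
  | nil => intro τ _ a ha; simp at ha
  | cons μ α ih =>
    intro τ h a ha
    cases α with
    | nil =>
      simp at ha
      subst ha
      exact ((hWFc _ _).1 h).2.2.2.1
    | cons ν α' =>
      rw [List.getLast?_cons_cons] at ha
      exact ih τ ((hWFc μ ((ν :: α') ++ τ)).1 h).1 a ha

/-- **Longest common suffix.**  Any two lists split as `α ++ τ`, `α' ++ τ` with distinct deepest prefix
letters (the condition is vacuous when one prefix is empty). -/
theorem exists_common_suffix {β : Type*} :
    ∀ (κ κ' : List β), ∃ α α' τ : List β, κ = α ++ τ ∧ κ' = α' ++ τ ∧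
      ∀ x ∈ α.getLast?, ∀ y ∈ α'.getLast?, x ≠ y := by
  classical
  intro κ
  induction κ using List.reverseRecOn with
  | nil => intro κ'; exact ⟨[], κ', [], rfl, by simp, by simp⟩
  | append_singleton l a ih =>
    intro κ'
    rcases List.eq_nil_or_concat κ' with rfl | ⟨l', a', rfl⟩
    · exact ⟨l ++ [a], [], [], by simp, rfl, by simp⟩
    · by_cases haa : a = a'
      · subst haa
        obtain ⟨α, α', τ, rfl, rfl, hne⟩ := ih l'
        exact ⟨α, α', τ ++ [a], by simp, by simp, hne⟩
      · exact ⟨l ++ [a], l' ++ [a'], [], by simp, by simp, by simpa using haa⟩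

/-- **Word rigidity.**  Two well-formed words with the same slot dozen are equal.  See the module docstring. -/
theorem word_eq_of_image_eq (hFc : ∀ μ κ, F (μ :: κ) = ((ℝ ∙ μ)ᗮ.reflection).trans (F κ))
    (huc : ∀ μ κ, u (μ :: κ) = -u κ)
    (hWFc : ∀ μ κ, WF (μ :: κ) ↔ (WF κ ∧ ‖μ‖ = 1 ∧
      (∀ w ∈ fccSlots, ⟪w, μ⟫_ℝ = 0 ∨ ⟪w, μ⟫_ℝ = Real.sqrt (2 / 3) ∨ ⟪w, μ⟫_ℝ = -Real.sqrt (2 / 3)) ∧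
      ⟪u κ, μ⟫_ℝ = Real.sqrt (2 / 3) ∧ ∀ μ' κ', κ = μ' :: κ' → μ' ≠ -μ))
    {κ κ' : List (EuclideanSpace ℝ (Fin 3))} (hκ : WF κ) (hκ' : WF κ')
    (himg : (F κ : EuclideanSpace ℝ (Fin 3) → EuclideanSpace ℝ (Fin 3)) '' ↑fccSlots =
      (F κ' : EuclideanSpace ℝ (Fin 3) → EuclideanSpace ℝ (Fin 3)) '' ↑fccSlots) : κ = κ' := by
  have hr : 0 < Real.sqrt (2 / 3) := Real.sqrt_pos.2 (by norm_num)
  obtain ⟨α, α', τ, rfl, rfl, hne⟩ := exists_common_suffix κ κ'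
  -- letters and chains of the two words
  obtain ⟨hlet, hchain⟩ := word_letters_of_wf huc hWFc _ hκ
  obtain ⟨hlet', hchain'⟩ := word_letters_of_wf huc hWFc _ hκ'
  have hαu : ∀ μ ∈ α, ‖μ‖ = 1 := fun μ hμ => (hlet μ (List.mem_append_left τ hμ)).1
  have hα'u : ∀ μ ∈ α', ‖μ‖ = 1 := fun μ hμ => (hlet' μ (List.mem_append_left τ hμ)).1
  -- it suffices that the glued list `α ++ α'.reverse` is empty
  suffices h : α ++ α'.reverse = [] by
    obtain ⟨h1, h2⟩ := List.append_eq_nil_iff.1 h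
    rw [h1, List.reverse_eq_nil_iff.1 h2]
  by_contra hL
  refine foldl_reflect_slots_false (α ++ α'.reverse) hL ?_ ?_ ?_
  · -- letters: unit model menu normals
    intro μ hμ
    rcases List.mem_append.1 hμ with h | h
    · exact hlet μ (List.mem_append_left τ h)
    · exact hlet' μ (List.mem_append_left τ (List.mem_reverse.1 h))
  · -- the chain condition
    rw [List.isChain_append]
    refine ⟨hchain.left_of_append, ?_, ?_⟩
    · rw [List.isChain_reverse]
      exact hchain'.left_of_append.imp fun a b h => by rw [real_inner_comm]; exact h
    · intro x hx y hy
      rw [List.head?_reverse] at hy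
      have hxy : x ≠ y := hne x hx y hy
      obtain ⟨hx1, hxm⟩ := hlet x (List.mem_append_left τ (List.mem_of_getLast? hx))
      obtain ⟨hy1, hym⟩ := hlet' y (List.mem_append_left τ (List.mem_of_getLast? hy))
      have hux : ⟪u τ, x⟫_ℝ = Real.sqrt (2 / 3) := word_inner_u_getLast hWFc α τ hκ x hx
      have huy : ⟪u τ, y⟫_ℝ = Real.sqrt (2 / 3) := word_inner_u_getLast hWFc α' τ hκ' y hy
      have hmx : ∀ w ∈ fccSlots,
          ⟪(LinearIsometryEquiv.refl ℝ (EuclideanSpace ℝ (Fin 3))) w, x⟫_ℝ = 0 ∨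
          ⟪(LinearIsometryEquiv.refl ℝ (EuclideanSpace ℝ (Fin 3))) w, x⟫_ℝ = Real.sqrt (2 / 3) ∨
          ⟪(LinearIsometryEquiv.refl ℝ (EuclideanSpace ℝ (Fin 3))) w, x⟫_ℝ = -Real.sqrt (2 / 3) := by
        intro w hw; simpa using hxm w hw
      have hmy : ∀ w ∈ fccSlots,
          ⟪(LinearIsometryEquiv.refl ℝ (EuclideanSpace ℝ (Fin 3))) w, y⟫_ℝ = 0 ∨
          ⟪(LinearIsometryEquiv.refl ℝ (EuclideanSpace ℝ (Fin 3))) w, y⟫_ℝ = Real.sqrt (2 / 3) ∨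
          ⟪(LinearIsometryEquiv.refl ℝ (EuclideanSpace ℝ (Fin 3))) w, y⟫_ℝ = -Real.sqrt (2 / 3) := by
        intro w hw; simpa using hym w hw
      rcases inner_menuNormals (LinearIsometryEquiv.refl ℝ _) hx1 hy1 hmx hmy with h | h | h | h
      · exact absurd ((inner_eq_one_iff_of_norm_eq_one (𝕜 := ℝ) hx1 hy1).1 h) hxy
      · have hyx : y = -x := eq_neg_of_inner_eq_neg_one' hx1 hy1 h
        rw [hyx, inner_neg_right, hux] at huy
        linarith
      · exact Or.inl h
      · exact Or.inr h
  · -- the glued mirror chain maps the slots into the slots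
    intro w hw
    have hmem : (F (α ++ τ) : EuclideanSpace ℝ (Fin 3) → EuclideanSpace ℝ (Fin 3)) w ∈
        (F (α' ++ τ) : EuclideanSpace ℝ (Fin 3) → EuclideanSpace ℝ (Fin 3)) '' ↑fccSlots := by
      rw [← himg]; exact Set.mem_image_of_mem _ (Finset.mem_coe.2 hw)
    obtain ⟨w', hw', heq⟩ := hmem
    rw [Finset.mem_coe] at hw'
    rw [word_F_append_apply hFc α hαu, word_F_append_apply hFc α' hα'u] at heq
    have heq' := (F τ).injective heq
    have key := foldl_reflect_reverse_foldl α' hα'u w'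
    rw [heq', ← List.foldl_append] at key
    rw [key]; exact hw'

/-- **Word rigidity, triangle form** (the `hroot`/`hlam` input of `word_sources_le`): if a `60°` triangle of
`F κ`-slots lies in the slot dozen of `F κ'` for well-formed words `κ, κ'`, then `κ = κ'`. -/
theorem word_eq_of_triangle (hFc : ∀ μ κ, F (μ :: κ) = ((ℝ ∙ μ)ᗮ.reflection).trans (F κ))
    (huc : ∀ μ κ, u (μ :: κ) = -u κ)
    (hWFc : ∀ μ κ, WF (μ :: κ) ↔ (WF κ ∧ ‖μ‖ = 1 ∧
      (∀ w ∈ fccSlots, ⟪w, μ⟫_ℝ = 0 ∨ ⟪w, μ⟫_ℝ = Real.sqrt (2 / 3) ∨ ⟪w, μ⟫_ℝ = -Real.sqrt (2 / 3)) ∧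
      ⟪u κ, μ⟫_ℝ = Real.sqrt (2 / 3) ∧ ∀ μ' κ', κ = μ' :: κ' → μ' ≠ -μ))
    {κ κ' : List (EuclideanSpace ℝ (Fin 3))} (hκ : WF κ) (hκ' : WF κ')
    (htri : ∃ a ∈ fccSlots, ∃ a' ∈ fccSlots, ∃ a'' ∈ fccSlots,
        ⟪a, a'⟫_ℝ = 1 / 2 ∧ ⟪a, a''⟫_ℝ = 1 / 2 ∧ ⟪a', a''⟫_ℝ = 1 / 2 ∧
        (∃ w ∈ fccSlots, F κ' w = F κ a) ∧ (∃ w ∈ fccSlots, F κ' w = F κ a') ∧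
        (∃ w ∈ fccSlots, F κ' w = F κ a'')) : κ = κ' := by
  obtain ⟨a, ha, a', ha', a'', ha'', i1, i2, i3, ⟨w₁, hw₁, e₁⟩, ⟨w₂, hw₂, e₂⟩, ⟨w₃, hw₃, e₃⟩⟩ := htri
  refine word_eq_of_image_eq hFc huc hWFc hκ hκ' ?_
  exact image_fccSlots_eq_of_triangle (F κ) (F κ') ha ha' ha'' i1 i2 i3
    ⟨w₁, Finset.mem_coe.2 hw₁, e₁⟩ ⟨w₂, Finset.mem_coe.2 hw₂, e₂⟩ ⟨w₃, Finset.mem_coe.2 hw₃, e₃⟩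

end Rigidity

end Summit.Ventures.Crystal3D.Theorems

end
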